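import Summits.CriticalPhenomena.CardyFormulaZ2.Theorems.CardyComplexConeParafermionToSLESixFamiliesDiamondIdentifyArgument
import HarnessLib

/-!
# Line `potential-darboux-picard-diamond`, stub S4 (`stub_identifyPotential`): the boundary argument of an injective circle map onto a convex frontier

Helper file of the stub `stub_identifyPotential` of crux `ParafermionToSLESixFamilies` (stmt-CriticalPhenomena-11389).
Step (iv) of the identification transports the disc statements of S2 to the diamond `D` through a Riemann map `R` whose
Carathéodory extension `Φ` maps the unit circle continuously and BIJECTIVELY onto `∂D` (`exists_riemannMap_extension`).
To know that `t ↦ Φ(e^{it})` runs around the convex polygon `∂D` ONCE and in the COUNTER-CLOCKWISE sense one needs: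
(1) a continuous argument `θ_R` of `Φ(e^{it}) − z₀` (`z₀ ∈ D`), (2) that it is strictly monotone with total change `±2π`
(this file: `boundaryArg_of_injOn_sphere`, registered helper of the crux item — each ray from an interior point of a convex
set meets its frontier once, `eq_of_frontier_of_sameRay`, so `θ_R` is injective on `[0, 2π)`; a continuous injective
function on an interval is strictly monotone; the intermediate value theorem bounds the total change), and (3) the sign
`+`, which is `TraceWindingNonneg` (S2) applied to `Φ = R` itself. Also provided: the continuous argument of a
non-vanishing continuous path on a compact interval (`exists_continuousArg`, path lifting through `exp`).
-/

noncomputable section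

namespace Summit.CriticalPhenomena.CardyFormulaZ2.Cruxes.ParafermionToSLESixFamilies.PotentialDarbouxPicardDiamond

open scoped Topology Real
open Filter Set Metric Complex

/-- **Continuous argument along a path.** A continuous path `γ` on `[a, b]` avoiding `w₀` has a continuous argument:
`γ s − w₀ = ‖γ s − w₀‖ e^{iθ(s)}` with `θ` continuous (path lifting for the covering map `exp`). -/
theorem exists_continuousArg (γ : ℝ → ℂ) (w₀ : ℂ) {a b : ℝ} (hab : a ≤ b) (hγ : ContinuousOn γ (Icc a b))
    (hne : ∀ s ∈ Icc a b, γ s ≠ w₀) :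
    ∃ θ : ℝ → ℝ, Continuous θ ∧ ∀ s ∈ Icc a b, γ s - w₀ = (‖γ s - w₀‖ : ℂ) * exp (θ s * I) := by
  set f : ℝ → ℂ := fun s => γ s - w₀ with hf
  have hfc : ContinuousOn f (Icc a b) := hγ.sub continuousOn_const
  have hfne : ∀ s ∈ Icc a b, f s ≠ 0 := fun s hs => sub_ne_zero.2 (hne s hs)
  have hmemI : ∀ σ : unitInterval, a + (b - a) * (σ : ℝ) ∈ Icc a b := fun σ =>
    ⟨le_add_of_nonneg_right (mul_nonneg (sub_nonneg.2 hab) σ.2.1),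
      by nlinarith [σ.2.1, σ.2.2, sub_nonneg.2 hab]⟩
  have hgc : Continuous fun σ : unitInterval => f (a + (b - a) * σ) :=
    hfc.comp_continuous (continuous_const.add (continuous_const.mul continuous_subtype_val)) hmemI
  set g : C(unitInterval, {z : ℂ // z ≠ 0}) :=
    ⟨fun σ => ⟨f (a + (b - a) * σ), hfne _ (hmemI σ)⟩, hgc.subtype_mk _⟩ with hg
  have hamem : a ∈ Icc a b := ⟨le_rfl, hab⟩
  have hg0 : g 0 = ⟨exp (log (f a)), exp_ne_zero _⟩ := by
    ext
    change f (a + (b - a) * (0 : unitInterval)) = exp (log (f a))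
    rw [exp_log (hfne a hamem)]
    simp
  obtain ⟨Γ, hΓ, -⟩ := Complex.isCoveringMap_exp.exists_path_lifts g (log (f a)) hg0
  have hexp : ∀ σ : unitInterval, exp (Γ σ) = f (a + (b - a) * σ) := fun σ => by
    have := congrArg (fun h : unitInterval → {z : ℂ // z ≠ 0} => ((h σ : {z : ℂ // z ≠ 0}) : ℂ)) hΓ
    exact this
  set θ : ℝ → ℝ := fun s => (Γ (projIcc (0 : ℝ) 1 zero_le_one ((s - a) / (b - a)))).im with hθ
  refine ⟨θ, continuous_im.comp (Γ.continuous.comp (continuous_projIcc.comp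
    ((continuous_id.sub continuous_const).div_const _))), fun s hs => ?_⟩
  have hσ : (s - a) / (b - a) ∈ Icc (0 : ℝ) 1 := by
    rcases eq_or_lt_of_le hab with h | h
    · simp [h]
    · exact ⟨div_nonneg (sub_nonneg.2 hs.1) (sub_pos.2 h).le,
        div_le_one_of_le₀ (sub_le_sub_right hs.2 _) (sub_pos.2 h).le⟩
  have hproj : projIcc 0 1 zero_le_one ((s - a) / (b - a)) = ⟨(s - a) / (b - a), hσ⟩ := projIcc_of_mem _ hσ
  have hsval : a + (b - a) * ((s - a) / (b - a)) = s := by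
    rcases eq_or_lt_of_le hab with h | h
    · have : s = a := le_antisymm (h ▸ hs.2) hs.1
      simp [h, this]
    · field_simp; ring
  have h1 : exp (Γ ⟨(s - a) / (b - a), hσ⟩) = f s := by
    rw [hexp]
    change f (a + (b - a) * ((s - a) / (b - a))) = f s
    rw [hsval]
  have hθs : θ s = (Γ ⟨(s - a) / (b - a), hσ⟩).im := by simp only [hθ, hproj]
  change f s = (‖f s‖ : ℂ) * exp (θ s * I)
  rw [hθs, ← h1, norm_exp, ofReal_exp, exp_mul_I, ← exp_eq_exp_re_mul_sin_add_cos]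

/-- **Each ray from an interior point of a convex set meets the frontier at most once.** -/
theorem eq_of_frontier_of_sameRay {K : Set ℂ} (hK : Convex ℝ K) {z₀ P Q : ℂ} (hz₀ : z₀ ∈ interior K)
    (hP : P ∈ frontier K) (hQ : Q ∈ frontier K) {r : ℝ} (hr : 0 < r) (hPQ : Q - z₀ = (r : ℂ) * (P - z₀)) :
    P = Q := by
  rcases lt_trichotomy r 1 with hlt | rfl | hgt
  · -- `Q` lies on the open segment from `z₀` to `P`, hence in the interior
    exfalso
    have hmem : Q ∈ openSegment ℝ z₀ P := by
      rw [openSegment_eq_image]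
      refine ⟨r, ⟨hr, hlt⟩, ?_⟩
      change (1 - r) • z₀ + r • P = Q
      rw [real_smul, real_smul]
      have : Q = z₀ + (r : ℂ) * (P - z₀) := by rw [← hPQ]; ring
      rw [this]; push_cast; ring
    exact hQ.2 (hK.openSegment_interior_closure_subset_interior hz₀ hP.1 hmem)
  · rw [ofReal_one, one_mul] at hPQ
    exact (sub_left_injective hPQ).symm
  · -- `P` lies on the open segment from `z₀` to `Q`
    exfalso
    have hmem : P ∈ openSegment ℝ z₀ Q := by
      rw [openSegment_eq_image]
      refine ⟨r⁻¹, ⟨inv_pos.2 hr, inv_lt_one_of_one_lt₀ hgt⟩, ?_⟩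
      change (1 - r⁻¹) • z₀ + r⁻¹ • Q = P
      rw [real_smul, real_smul]
      have hr0 : (r : ℂ) ≠ 0 := by exact_mod_cast hr.ne'
      have : P = z₀ + (r : ℂ)⁻¹ * (Q - z₀) := by rw [hPQ, ← mul_assoc, inv_mul_cancel₀ hr0]; ring
      rw [this]; push_cast; ring
    exact hP.2 (hK.openSegment_interior_closure_subset_interior hz₀ hQ.1 hmem)

/-- `t ↦ e^{it}` is injective on `[0, 2π)`. -/
theorem eq_of_exp_mul_I_eq {t t' : ℝ} (ht : t ∈ Ico 0 (2 * π)) (ht' : t' ∈ Ico 0 (2 * π))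
    (h : exp ((t : ℂ) * I) = exp ((t' : ℂ) * I)) : t = t' := by
  obtain ⟨n, hn⟩ := Complex.exp_eq_exp_iff_exists_int.1 h
  have hre : t = t' + n * (2 * π) := by
    have := congrArg Complex.im hn
    simpa using this
  have habs : |t - t'| < 2 * π := by rw [abs_lt]; constructor <;> linarith [ht.1, ht.2, ht'.1, ht'.2]
  rw [hre, add_sub_cancel_left, abs_mul, abs_of_pos Real.two_pi_pos] at habs
  have hn1 : |(n : ℝ)| < 1 := by
    by_contra hcon
    push Not at hcon
    have : 2 * π * 1 ≤ |(n:ℝ)| * (2 * π) := by nlinarith [Real.two_pi_pos]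
    linarith
  have hn0 : n = 0 := Int.abs_lt_one_iff.1 (by exact_mod_cast hn1)
  rw [hre, hn0]; simp

/-- The monotone case of the dichotomy: a continuous `θ` on `[0, 2π]`, injective modulo `2π` on `[0, 2π)`, with
`θ(2π) ≡ θ(0) (mod 2π)` and strictly increasing on `[0, π]`, is strictly increasing on `[0, 2π]` with
`θ(2π) = θ(0) + 2π`. -/
theorem strictMonoOn_of_injOn_angle {θ : ℝ → ℝ} (hθc : ContinuousOn θ (Icc 0 (2 * π)))
    (hinj : ∀ s ∈ Ico 0 (2 * π), ∀ s' ∈ Ico 0 (2 * π), (θ s : Real.Angle) = θ s' → s = s')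
    (hper : ((θ (2 * π) : ℝ) : Real.Angle) = θ 0) (hmono : StrictMonoOn θ (Icc 0 π)) :
    StrictMonoOn θ (Icc 0 (2 * π)) ∧ θ (2 * π) = θ 0 + 2 * π := by
  have hπ := Real.pi_pos
  have hinjR : ∀ b, b < 2 * π → InjOn θ (Icc 0 b) := fun b hb s hs s' hs' h =>
    hinj s ⟨hs.1, hs.2.trans_lt hb⟩ s' ⟨hs'.1, hs'.2.trans_lt hb⟩ (by rw [h])
  have hall : ∀ b, π ≤ b → b < 2 * π → StrictMonoOn θ (Icc 0 b) := by
    intro b hb1 hb2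
    rcases (hθc.mono (Icc_subset_Icc_right hb2.le)).strictMonoOn_of_injOn_Icc' (hπ.le.trans hb1) (hinjR b hb2)
      with h | h
    · exact h
    · exfalso
      have h1 := hmono ⟨le_rfl, hπ.le⟩ ⟨hπ.le, le_rfl⟩ hπ
      have h2 := h ⟨le_rfl, hπ.le.trans hb1⟩ ⟨hπ.le, hb1⟩ hπ
      linarith
  have hmonoIco : StrictMonoOn θ (Ico 0 (2 * π)) := by
    intro s hs s' hs' hss'
    have hb : π ≤ max π s' := le_max_left _ _
    have hb2 : max π s' < 2 * π := max_lt (by linarith) hs'.2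
    exact hall _ hb hb2 ⟨hs.1, hss'.le.trans (le_max_right _ _)⟩ ⟨hs'.1, le_max_right _ _⟩ hss'
  have hlim : ∀ s ∈ Ico 0 (2 * π), θ s ≤ θ (2 * π) := by
    intro s hs
    have h2π : (2 * π) ∈ Icc 0 (2 * π) := ⟨by linarith, le_rfl⟩
    have hcw : ContinuousWithinAt θ (Iio (2 * π)) (2 * π) :=
      (hθc (2 * π) h2π).mono_of_mem_nhdsWithin
        (mem_of_superset (Ioo_mem_nhdsLT Real.two_pi_pos) Ioo_subset_Icc_self)
    refine ge_of_tendsto hcw.tendsto ?_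
    filter_upwards [Ico_mem_nhdsLT hs.2] with t hts
    rcases eq_or_lt_of_le hts.1 with h | hlt
    · rw [h]
    · exact (hmonoIco hs ⟨hs.1.trans hts.1, hts.2⟩ hlt).le
  have hmonoIcc : StrictMonoOn θ (Icc 0 (2 * π)) := by
    intro s hs s' hs' hss'
    rcases eq_or_lt_of_le hs'.2 with h | hlt'
    · have hsI : s ∈ Ico 0 (2 * π) := ⟨hs.1, h ▸ hss'⟩
      have hm : (s + 2 * π) / 2 ∈ Ico 0 (2 * π) := ⟨by linarith [hs.1], by linarith [hsI.2]⟩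
      rw [h]
      exact (hmonoIco hsI hm (by linarith [hsI.2])).trans_le (hlim _ hm)
    · exact hmonoIco ⟨hs.1, hss'.trans hlt'⟩ ⟨hs'.1, hlt'⟩ hss'
  refine ⟨hmonoIcc, ?_⟩
  obtain ⟨n, hn⟩ := Real.Angle.angle_eq_iff_two_pi_dvd_sub.1 hper
  have hpos : θ 0 < θ (2 * π) := hmonoIcc ⟨le_rfl, by linarith⟩ ⟨by linarith, le_rfl⟩ Real.two_pi_pos
  have hn1 : (1 : ℤ) ≤ n := by
    have h1 : (0:ℝ) < 2 * π * n := by linarith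
    have h2 : (0:ℝ) < n := (mul_pos_iff_of_pos_left Real.two_pi_pos).1 h1
    have h3 : (0:ℤ) < n := by exact_mod_cast h2
    omega
  have hn2 : n < 2 := by
    by_contra hge
    push Not at hge
    have hge' : (2:ℝ) ≤ n := by exact_mod_cast hge
    have h4 : θ 0 + 2 * π ∈ Icc (θ 0) (θ (2 * π)) := ⟨by linarith, by nlinarith⟩
    obtain ⟨t, ht, htv⟩ := intermediate_value_Icc Real.two_pi_pos.le hθc h4
    have ht2 : t < 2 * π := by
      rcases eq_or_lt_of_le ht.2 with h | h
      · exfalso; rw [h] at htv; nlinarith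
      · exact h
    have hA : (θ t : Real.Angle) = θ 0 := by
      rw [htv, Real.Angle.coe_add, Real.Angle.coe_two_pi, add_zero]
    have := hinj t ⟨ht.1, ht2⟩ 0 ⟨le_rfl, Real.two_pi_pos⟩ hA
    rw [this] at htv
    linarith
  have hn' : n = 1 := by omega
  rw [hn', Int.cast_one, mul_one] at hn
  linarith

/-- **Boundary argument of an injective circle map onto the frontier of a convex set.** Let `K ⊆ ℂ` be convex with
`z₀ ∈ interior K`, and let `Φ` be continuous and injective on the unit circle with values in `frontier K` (e.g. the
Carathéodory extension of a conformal map of the disc onto a convex Jordan domain). Then `t ↦ Φ(e^{it}) − z₀` has a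
continuous argument `θ` on `[0, 2π]` which is EITHER strictly increasing with `θ(2π) = θ(0) + 2π` OR strictly decreasing
with `θ(2π) = θ(0) − 2π`; `TraceWindingNonneg` (S2) excludes the second case for boundary maps of holomorphic functions. -/
theorem boundaryArg_of_injOn_sphere : ∀ (K : Set ℂ) (z₀ : ℂ) (Φ : ℂ → ℂ), Convex ℝ K → z₀ ∈ interior K → ContinuousOn Φ (Metric.sphere (0:ℂ) 1) → InjOn Φ (Metric.sphere (0:ℂ) 1) → MapsTo Φ (Metric.sphere (0:ℂ) 1) (frontier K) → ∃ θ : ℝ → ℝ, ContinuousOn θ (Icc 0 (2 * Real.pi)) ∧ (∀ t ∈ Icc (0:ℝ) (2 * Real.pi), Φ (exp (t * I)) ≠ z₀ ∧ Φ (exp (t * I)) - z₀ = (‖Φ (exp (t * I)) - z₀‖ : ℂ) * exp (θ t * I)) ∧ ((StrictMonoOn θ (Icc 0 (2 * Real.pi)) ∧ θ (2 * Real.pi) = θ 0 + 2 * Real.pi) ∨ (StrictAntiOn θ (Icc 0 (2 * Real.pi)) ∧ θ (2 * Real.pi) = θ 0 - 2 * Real.pi)) := by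
  intro K z₀ Φ hK hz₀ hΦc hΦi hΦf
  have hπ := Real.pi_pos
  set γ : ℝ → ℂ := fun t => Φ (exp (t * I)) with hγ
  have hsph : ∀ t : ℝ, exp ((t : ℂ) * I) ∈ sphere (0:ℂ) 1 := fun t => by
    rw [mem_sphere_zero_iff_norm, norm_exp_ofReal_mul_I]
  have hec : Continuous fun t : ℝ => exp ((t : ℂ) * I) := by fun_prop
  have hγc : ContinuousOn γ (Icc 0 (2 * π)) := hΦc.comp hec.continuousOn fun t _ => hsph t
  have hfr : ∀ t, γ t ∈ frontier K := fun t => hΦf (hsph t)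
  have hne : ∀ t, γ t ≠ z₀ := fun t h => (hfr t).2 (by rw [h]; exact hz₀)
  obtain ⟨θ, hθc, hpol⟩ := exists_continuousArg γ z₀ Real.two_pi_pos.le hγc (fun t _ => hne t)
  have hang : ∀ t ∈ Icc 0 (2 * π), (arg (γ t - z₀) : Real.Angle) = θ t := fun t ht =>
    arg_coe_angle_of_polar (sub_ne_zero.2 (hne t)) (hpol t ht)
  -- injectivity modulo `2π` on `[0, 2π)`: equal angles ⇒ same ray ⇒ same frontier point ⇒ same parameter
  have hinj : ∀ s ∈ Ico 0 (2 * π), ∀ s' ∈ Ico 0 (2 * π), (θ s : Real.Angle) = θ s' → s = s' := by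
    intro s hs s' hs' h
    have hs1 : s ∈ Icc 0 (2 * π) := Ico_subset_Icc_self hs
    have hs'1 : s' ∈ Icc 0 (2 * π) := Ico_subset_Icc_self hs'
    have hexpθ : exp ((θ s' : ℂ) * I) = exp ((θ s : ℂ) * I) := by
      obtain ⟨k, hk⟩ := Real.Angle.angle_eq_iff_two_pi_dvd_sub.1 h.symm
      have hk' : θ s' = θ s + 2 * π * k := by linarith
      have : (θ s' : ℂ) * I = (θ s : ℂ) * I + k * (2 * π * I) := by rw [hk']; push_cast; ring
      rw [this, Complex.exp_add, exp_int_mul_two_pi_mul_I, mul_one]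
    have hA := hpol s hs1
    have hB := hpol s' hs'1
    rw [hexpθ] at hB
    have hray : γ s' - z₀ = ((‖γ s' - z₀‖ / ‖γ s - z₀‖ : ℝ) : ℂ) * (γ s - z₀) := by
      have hn0 : (‖γ s - z₀‖ : ℂ) ≠ 0 := by exact_mod_cast norm_ne_zero_iff.2 (sub_ne_zero.2 (hne s))
      set a : ℝ := ‖γ s - z₀‖ with ha
      set b : ℝ := ‖γ s' - z₀‖ with hb
      set u : ℂ := exp ((θ s : ℂ) * I) with hu
      calc γ s' - z₀ = (b : ℂ) * u := hB
        _ = ((b / a : ℝ) : ℂ) * ((a : ℂ) * u) := by push_cast; field_simp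
        _ = ((b / a : ℝ) : ℂ) * (γ s - z₀) := by rw [← hA]
    have hr : 0 < ‖γ s' - z₀‖ / ‖γ s - z₀‖ :=
      div_pos (norm_pos_iff.2 (sub_ne_zero.2 (hne s'))) (norm_pos_iff.2 (sub_ne_zero.2 (hne s)))
    have heq : γ s = γ s' := eq_of_frontier_of_sameRay hK hz₀ (hfr s) (hfr s') hr hray
    exact eq_of_exp_mul_I_eq hs hs' (hΦi (hsph s) (hsph s') heq)
  have hper : ((θ (2 * π) : ℝ) : Real.Angle) = θ 0 := by
    have h2π : (2 * π) ∈ Icc 0 (2 * π) := ⟨by linarith, le_rfl⟩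
    have h0 : (0:ℝ) ∈ Icc 0 (2 * π) := ⟨le_rfl, by linarith⟩
    have hγeq : γ (2 * π) = γ 0 := by
      simp only [hγ]
      congr 1
      push_cast
      rw [exp_two_pi_mul_I, zero_mul, Complex.exp_zero]
    rw [← hang _ h2π, ← hang _ h0, hγeq]
  refine ⟨θ, hθc.continuousOn, fun t ht => ⟨hne t, hpol t ht⟩, ?_⟩
  have hinjπ : InjOn θ (Icc 0 π) := fun s hs s' hs' h =>
    hinj s ⟨hs.1, by linarith [hs.2]⟩ s' ⟨hs'.1, by linarith [hs'.2]⟩ (by rw [h])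
  rcases (hθc.continuousOn.mono (Icc_subset_Icc_right (by linarith : π ≤ 2 * π))).strictMonoOn_of_injOn_Icc'
      hπ.le hinjπ with hm | ha
  · exact Or.inl (strictMonoOn_of_injOn_angle hθc.continuousOn hinj hper hm)
  · right
    have hinj' : ∀ s ∈ Ico 0 (2 * π), ∀ s' ∈ Ico 0 (2 * π),
        ((-θ s : ℝ) : Real.Angle) = ((-θ s' : ℝ) : Real.Angle) → s = s' := fun s hs s' hs' h =>
      hinj s hs s' hs' (by rwa [Real.Angle.coe_neg, Real.Angle.coe_neg, neg_inj] at h)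
    have hper' : ((-θ (2 * π) : ℝ) : Real.Angle) = ((-θ 0 : ℝ) : Real.Angle) := by
      rw [Real.Angle.coe_neg, Real.Angle.coe_neg, hper]
    obtain ⟨h1, h2⟩ := strictMonoOn_of_injOn_angle (θ := fun s => -θ s) hθc.continuousOn.neg hinj' hper' ha.neg
    refine ⟨fun s hs s' hs' hss' => ?_, by linarith⟩
    have := h1 hs hs' hss'
    simpa using this

end Summit.CriticalPhenomena.CardyFormulaZ2.Cruxes.ParafermionToSLESixFamilies.PotentialDarbouxPicardDiamond

end
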